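import Summits.QuantumFields.BalabanUV.T4Continuum.Support.ShellMeasureLandauEndWindowRestrictRel
import Summits.QuantumFields.BalabanUV.T4Continuum.Support.ShellMeasureWindowReachCollar
import Summits.QuantumFields.BalabanUV.T4Continuum.Support.ShellMeasureLevelZeroBoxWitness

/-!
# `T4Continuum.ShellMeasureLandauEndWindowReach` — row S87 f4 «γ3 END-TO-END»: the live-level END-II-final on the block's
# BOX with the window binder GONE — displayed instead: the CORE reading (sub-threshold ⟹ `□^∼`-plaquettes small), the
# COLLAR support reading (`F ≠ 0` ⟹ collar plaquettes small), a cover, S1's box geometry; + the `B := ∅` corollary; +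
# rule G-1's joint-inhabitation witness on leaf-10-g11's concrete torus box
(cell `pub-balaban`, sub-cell `t4`, spine estimate NE7c (node U5b); NE7c ROUND-2 crew, unit
`b2b-balaban-t4-ne7c-formalise-leaf-03` gen 6; owner table `t4/b2b-balaban-t4-ne7c-p1/LEAVES-NE7c-P1.md` row **S87** (owner g32
f1 p228621; f2 `ShellMeasureLandauEndWindowRestrict` p229117 + f2b `ShellMeasureLandauEndWindowRestrictRel` = this lineage; f3
`ShellMeasureWindowReachLive` p229141 = leaf-08-g14; collar `ShellMeasureWindowReachCollar` p229745 = leaf-01-g8; owner g33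
GO «with (x1) MANDATORY» R-ne7cp1-g33-1 (d) l.18516; INTENT l.18428, RESPONSE l.18592); ADDITIVE — imports f2b + the collar
file + leaf-10-g11's S89 `ShellMeasureLevelZeroBoxWitness` (p-landed; the concrete torus box for (x1)) ONLY; [folklore];
0 `def`, 0 `def … : Prop`, 0 sorry, 0 citation tags)

HONEST FRAMING.  Finite four-torus programme, rung (B)+1 only — NOT infinite volume, NOT a mass gap, NOT the Clay
problem, NOT summit progress; (B), `BetaPertHyp`, (B^μ) not consumed.  NE7c (`T4IndicatorShell.ShellWeightBound`) is
NOT PRINTED in [Balaban 1983–89] and NOT PROVED; «NE7c ⇐ the named binders» (trigger c3); (M1) realized ≠ NE7c.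
Nothing printed is asserted: B14 (2.16)∕(2.17), B15 (1.3)–(1.9), [Balaban1985Averaging] Props 1∕2 and the scheme equation
numbers LOCATE the displayed SHAPES of binders; no estimate of Bałaban's is discharged.  HONEST DEPENDENCY (cell):
continuum YM on T⁴ ⇐ BetaPertH ∧ nine spine estimates (0/9 proved); BetaPertH ⇐ (D1) ∧ (D4) ∧ CAP+tail; G-an2-4 gates
asym, D1 and NE2/3/4.

WHAT THIS FILE PROVES (compositions BY NAME; ONE call each):
* §1 **`slotAC_realized_su2_landauChart_final_of_core_collar`** — THE γ3 FORM OF RECORD (the linear radius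
  `(d−1)·nb·a ≤ 2S∕π` is ONE call of S87 f3 `rad_of_linear` with `le_pi_of_three_sq_lt` away): S87 f2b
  `…_final_of_reach'` AT `T := combBonds lo hi` (loop-free by `T4TreeGaugeFixing.noClosedLoop_combBonds` under the displayed
  non-wrapping `hi − lo < sitesPerDir`), `U₀ := 1`, `c := 1`, with `hreach′ := ShellMeasureWindowReachCollar.hreach'_of_core_collar`;
  binders = S76 f2's VERBATIM minus `hFsupp` (and `T hT U₀ c`) plus the box data {`hn`, `hN`, `hΛbox`, `hΛcomb`, `ha0`,
  `hrad`, `hcover`, `hcore`, `hcollar`}; conclusion IDENTICAL to S76 f2's;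
* §2 **`slotAC_realized_su2_landauChart_final_of_plaqSmall`** — the `B := ∅` corollary over S87 f3 `hreach_of_plaqSmall` and
  S87 f2 `…_final_of_reach` (one reading `hsmall` on the whole box; TRUE, not the reading of record);
* §3 (x1) **`reach_family_inhabited`** — CREW RULE G-1: on leaf-10-g11's concrete torus `toyParams` (`d = 2`, six sites per
  direction), level `0`, the side-2 box at corner `0`: `hn`, `hN`, `NoClosedLoop (comb)`, `Λ := blockBonds ≠ ∅`, `hΛbox`,
  `hΛcomb`, `3·S² < π²` with `S = 1`, radius `(d−1)·2·a ≤ 2 sin(S∕2)` with `a = sin(1∕2) > 0`, the box plaquettes NONEMPTY,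
  and the readings NON-VACUOUSLY — core: the tested variable IS the box maximum `max_{p ∈ box} dist1(U(∂p))` with
  `θ := a` (B14 (2.17)'s shape at `k = 0`); collar: `F := 𝟙{PlaqSmallOn box a}` (the kept co-test IS the support property);
  cover: trivial — ALL JOINTLY, and `hreach'_of_core_collar` FIRES on them (the END's support-relative reach PRODUCED on a
  nonempty block with genuine readings).
NOTHING in the countdown moves; NE7c NOT PROVED; spine PROVED 0∕9.
-/


noncomputable section

open Set Metric NormedSpace MeasureTheory Function

namespace Summit.QuantumFields.BalabanUV.T4Continuum.ShellMeasureLandauEndWindowReach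

open scoped ENNReal
open Literature.MathematicalPhysics.QuantumFieldTheory.Balaban1983to89
open B11Prop6Scheme (Prop4Hyp)
open GaugeField (GaugeInvariant)
open T4ShellMeasure (SlotAntiConcentration)
open T4CubePoincare (cube)
open T4CubeChartGnomonic (SU2)
open T4CubeChartExp (expFibreChart)
open T4TreeGaugeFixing (NoClosedLoop fixTo noClosedLoop_combBonds)
open T4ShellMeasurePlaquette (expTail₂)
open ShellMeasureLevelAssembly (classifier)
open ShellMeasureLandauHolonomy (solAt landauExp)
open ShellMeasureLandauHolonomyChart (holOf cplx)
open ShellMeasureLandauHolonomySkew (readOutReal)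
open T4AxialGaugeSmallField (boxPlaqs boxBonds)
open T4AxialGaugeFixing (combBonds)
open ShellMeasureLandauEndWindowRestrict (slotAC_realized_su2_landauChart_final_of_reach)
open ShellMeasureLandauEndWindowRestrictRel (slotAC_realized_su2_landauChart_final_of_reach')
open ShellMeasureWindowReachLive (hreach_of_plaqSmall rad_of_linear le_pi_of_three_sq_lt)
open ShellMeasureWindowReachCollar (hreach'_of_core_collar)
open ShellMeasureLevelZeroBoxWitness (toyParams toyParams_sitesPerDir blockBonds boxPlaqF mem_boxPlaqF blockBonds_box
  disjoint_blockBonds_comb blockBonds_nonempty boxPlaqF_nonempty dir_zero_lt_one side_two_nonwrapping side_two_side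
  side_two_square)

section Final

open scoped Matrix.Norms.L2Operator

variable {P : Params} {j : ℕ} [DecidableEq (PBond P j)]
variable {n : Type*} [Fintype n] [DecidableEq n] [Nonempty n]
variable {𝒴 𝒴' 𝒳 𝒵 ℬ : Type*} [NormedAddCommGroup 𝒴] [NormedSpace ℂ 𝒴] [CompleteSpace 𝒴]
  [NormedAddCommGroup 𝒴'] [NormedSpace ℂ 𝒴'] [NormedAddCommGroup 𝒳] [NormedSpace ℂ 𝒳] [CompleteSpace 𝒳]
  [NormedAddCommGroup 𝒵] [NormedSpace ℂ 𝒵] [NormedAddCommGroup ℬ] [NormedSpace ℂ ℬ]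

/-- **END-II-FINAL ON THE BLOCK'S BOX WITH THE γ3 INPUT OF RECORD — core reading + collar support reading
(row S87 f4).**  S87 f2b's END (`…_final_of_reach'`, SUPPORT-RELATIVE reach) at the axial-comb tree gauge of the
non-wrapping box `[lo, hi]` (`nb` unit steps per direction), centre `1`, with its reach binder PRODUCED by leaf-01-g8's
`ShellMeasureWindowReachCollar.hreach'_of_core_collar` from S1's axial reach (S87 f3 `dist1_section_le`) and the PAIR of
located readings: CORE («`u < εθη²` at a comb-fixed section ⟹ the `A`-plaquettes are `a`-small», `A ⊇ plaqs(□^∼)` —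
B14 (2.16)–(2.17) + [Balaban1985Averaging] Props 1∕2 TYPE) and COLLAR («`F ≠ 0` ⟹ the `B`-plaquettes are `a`-small» — the
density's KEPT co-tests, B15 (1.3)–(1.9) TYPE; S2's level-0 precedent), `boxPlaqs ⊆ A ∪ B`, radius
`(d−1)·nb·a ≤ 2 sin(S∕2)`.  Every other hypothesis is S76 f2's VERBATIM (at `T := combBonds lo hi`, `U₀ := 1`, `c := 1`).
CONCLUSION: `SlotAntiConcentration ((fieldMeasure P j SU2).withDensity F) u (εθ·η²) ρ (2(m₀ + (B_W + B_E))∕(1−δ))`.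
CONDITIONAL on every binder; readings NOT asserted; NOT Bałaban's minimiser; (M1) realized ≠ NE7c. [folklore] -/
theorem slotAC_realized_su2_landauChart_final_of_core_collar
    -- the BOX `[lo, hi]` (the block `□^{∼4}`: `nb` unit steps per direction, non-wrapping on the torus) and its axial comb
    {lo hi : Fin P.d → ℤ} {nb : ℕ} (hn : ∀ κ, hi κ ≤ lo κ + nb) (hN : ∀ κ, hi κ - lo κ < P.sitesPerDir j)
    (Λ : Finset (PBond P j)) (hΛbox : ∀ b ∈ Λ, b ∈ boxBonds lo hi) (hΛcomb : Disjoint Λ (combBonds lo hi))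
    {m₀ : ℕ} (e : ↥Λ × Fin 3 ≃ Fin m₀)
    {S : ℝ} (hS : 0 < S) (hSπ : 3 * S ^ 2 < Real.pi ^ 2)
    {F : GaugeField P j SU2 → ℝ≥0∞} (hF : Measurable F) (hFi : GaugeInvariant F)
    {u : GaugeField P j SU2 → ℝ} (hu : Measurable u) (hui : GaugeInvariant u)
    {ι : Type*} {Pu : Finset ι} (hPu : Pu.Nonempty)
    (W : GaugeField P j SU2 → Set (Fin m₀ → ℝ)) (Jco : GaugeField P j SU2 → (Fin m₀ → ℝ) → ℝ≥0∞)
    {δ ρ β : ℝ}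
    (𝒢 : GaugeField P j SU2 → (𝒵 →L[ℂ] 𝒴)) (W𝒱 : GaugeField P j SU2 → 𝒴 → 𝒵) {B₀ C₄ a₃ ε₄ : ℝ}
    (h𝒢 : ∀ V f, ‖𝒢 V f‖ ≤ B₀ * ‖f‖) (hW : ∀ V, Prop4Hyp (W𝒱 V) C₄ a₃) (hB₀ : 0 < B₀) (hC₄ : 0 ≤ C₄)
    (hε₄ : 0 ≤ ε₄)
    {dL C₁ B₃ ε₁ : ℝ} (hdL : 0 ≤ dL) (hC₁ : 0 ≤ C₁) (hε₁ : 0 ≤ ε₁) (hB₃ : dL ≤ B₃)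
    (h1 : 2 * B₀ * C₁ * B₃ * ε₁ ≤ ε₄) (h2 : 4 * ε₄ ≤ a₃) (h3 : 16 * B₀ * C₄ * ε₄ ≤ 1)
    (H₁ : GaugeField P j SU2 → (ℬ →L[ℂ] 𝒴)) (hH₁ : ∀ V B, ‖H₁ V B‖ ≤ B₀ * ‖B‖)
    (Φ : GaugeField P j SU2 → (Fin m₀ → ℂ) → ℬ) {rΦ : ℝ} (hΦd : ∀ V, DifferentiableOn ℂ (Φ V) (ball 0 rΦ))
    (hΦ0 : ∀ V, Φ V 0 = 0) (hΦ : ∀ V, ∀ z ∈ ball (0 : Fin m₀ → ℂ) rΦ, ‖Φ V z‖ < 2 * dL * C₁ * ε₁) (hSr : S < rΦ)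
    (Cf : GaugeField P j SU2 → 𝒴' → 𝒳) {C₂ RC : ℝ} (hC₂ : 0 ≤ C₂)
    (hCq : ∀ V, ∀ Z : 𝒴', ‖Z‖ < RC → ‖Cf V Z‖ ≤ C₂ * ‖Z‖ ^ 2) (hCd : ∀ V, DifferentiableOn ℂ (Cf V) (ball 0 RC))
    (ιs : GaugeField P j SU2 → (𝒴 →L[ℂ] 𝒴')) (hι : ∀ V Y, ‖ιs V Y‖ ≤ ‖Y‖)
    (Hop : GaugeField P j SU2 → (𝒳 →L[ℂ] 𝒴)) (hH : ∀ V X, ‖Hop V X‖ ≤ B₀ * ‖X‖)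
    {ε₃ : ℝ} (h18 : 18 * C₂ * B₀ * ε₃ ≤ 1) (hcoup : ε₄ + B₀ * (2 * dL * C₁ * ε₁) ≤ ε₃) (h3R : 3 * ε₃ ≤ RC)
    (ℓs : ι → List (𝒴 →L[ℂ] Matrix n n ℂ)) {κr : ℝ} (hκ : 0 ≤ κr)
    (hℓ : ∀ p ∈ Pu, ∀ ℓ ∈ ℓs p, ∀ Y, ‖ℓ Y‖ ≤ κr * ‖Y‖) {m : ℕ} (hlen : ∀ p ∈ Pu, (ℓs p).length ≤ m)
    {κc : ℝ} (hκc : 0 ≤ κc) (hcurl : ∀ p ∈ Pu, ∀ Y, ‖((ℓs p).map fun ℓ => ℓ Y).sum‖ ≤ κc * ‖Y‖)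
    -- THE TWO 𝓔-SLOTS (R-ne7cp1-g31-1): the WILSON part `𝓔W` (S74 `hE_landau_wilsonSquares(_pinned)` fills `hEW`; the Wilson
    -- density is nonnegative: `hWlb`) and the NON-WILSON part `𝓔E` (S71 f2 ∕ S78 fills `hEE`; a displayed lower bound `hElb`)
    (𝓔W 𝓔E : GaugeField P j SU2 → (Fin m₀ → ℝ) → ℝ) {BW BE BElb : ℝ}
    (hEW : ∀ V, ∀ x ∈ W V, ∀ c' : ℝ, 1 / 2 ≤ c' → c' ≤ 1 → 𝓔W V (c' • x) ≤ 𝓔W V x + (1 - c') * BW) (hBW : 0 ≤ BW)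
    (hEE : ∀ V, ∀ x ∈ W V, ∀ c' : ℝ, 1 / 2 ≤ c' → c' ≤ 1 → 𝓔E V (c' • x) ≤ 𝓔E V x + (1 - c') * BE) (hBE : 0 ≤ BE)
    (hWlb : ∀ V (y : Fin m₀ → ℝ), ‖y‖ ≤ S → 0 ≤ 𝓔W V y)
    (hElb : ∀ V (y : Fin m₀ → ℝ), ‖y‖ ≤ S → -BElb ≤ 𝓔E V y)
    (L : Set (𝒴 →L[ℂ] Matrix n n ℂ))
    (𝓡𝒵 : AddSubgroup 𝒵) (𝓡𝒴' : AddSubgroup 𝒴') (𝓡𝒳 : AddSubgroup 𝒳) (h𝓡𝒳 : IsClosed (𝓡𝒳 : Set 𝒳))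
    (𝓡ℬ : AddSubgroup ℬ)
    (h𝒢r : ∀ V, ∀ f ∈ 𝓡𝒵, 𝒢 V f ∈ readOutReal L) (hWr : ∀ V, ∀ Y ∈ readOutReal L, W𝒱 V Y ∈ 𝓡𝒵)
    (hιr : ∀ V, ∀ Y ∈ readOutReal L, ιs V Y ∈ 𝓡𝒴') (hHr : ∀ V, ∀ X ∈ 𝓡𝒳, Hop V X ∈ readOutReal L)
    (hCr : ∀ V, ∀ Z ∈ 𝓡𝒴', Cf V Z ∈ 𝓡𝒳) (hH₁r : ∀ V, ∀ B ∈ 𝓡ℬ, H₁ V B ∈ readOutReal L)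
    (hΦr : ∀ V, ∀ y : Fin m₀ → ℝ, ‖y‖ ≤ S → Φ V (cplx y) ∈ 𝓡ℬ)
    (hRdict : ∀ V, ∀ x ∈ cube m₀ S,
      F (fixTo (combBonds lo hi) 1 (updateFinset V Λ (expFibreChart Λ 1 e x))) =
        Jco V x * ENNReal.ofReal (Real.exp (-(𝓔W V x + 𝓔E V x))))
    (hudict : ∀ V, ∀ x ∈ cube m₀ S,
      u (fixTo (combBonds lo hi) 1 (updateFinset V Λ (expFibreChart Λ 1 e x))) =
        classifier hPu (fun p => holOf (ℓs p) (fun y => landauExp (Cf V) (ιs V) (Hop V)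
          (4 * C₂ * (ε₄ + B₀ * (2 * dL * C₁ * ε₁)) ^ 2)
          (solAt (𝒢 V) 0 (W𝒱 V) ε₄ (0 : 𝒵) (H₁ V (Φ V (cplx y))) + H₁ V (Φ V (cplx y))))) x)
    (hJW : ∀ V x, Jco V x ≠ 0 → x ∈ W V)
    (hJ : ∀ V x, ∀ a : ℝ, 0 ≤ a → Jco V x ≤ Jco V (Real.exp (-a) • x))
    (hJ1 : ∀ V x, Jco V x ≤ 1)
    (hWS : ∀ V, W V ⊆ closedBall (0 : Fin m₀ → ℝ) S)
    (hδ0 : 0 ≤ δ) (hδ1 : δ < 1) (hρ0 : 0 ≤ ρ) (hρ : ρ ≤ (1 - δ) / 2) (hβ : 0 ≤ β)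
    -- SM-L2 (SM) DISCHARGED IN THE STOKES CURRENCY (S73 `hSM_of_stokes`): the η-scalings of the classifier's read-out data
    -- DISPLAYED — curl read-out × field size `κ_c·z̄ ≤ c₁η²z` (B11 (25)∕(37) TYPE), letter size `κ_r·z̄ ≤ c₂ηz` ((19) TYPE),
    -- regime `m·κ_r·z̄ ≤ 1` — the UNIT-currency smallness `36(c₁z + m²c₂²z²)∕(r_Φ∕S − 1)² ≤ δ·εθ`, and the classifier
    -- threshold `θ := εθ·η²` (B14 (2.17) TYPE): the `η²` CANCELS
    {η εθ c₁ c₂ z : ℝ} (hη : 0 < η) (hεθ : 0 < εθ)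
    (hs₁ : κc * ((ε₄ + B₀ * (2 * dL * C₁ * ε₁)) + B₀ * (4 * C₂ * (ε₄ + B₀ * (2 * dL * C₁ * ε₁)) ^ 2)) ≤ c₁ * η ^ 2 * z)
    (ha : κr * ((ε₄ + B₀ * (2 * dL * C₁ * ε₁)) + B₀ * (4 * C₂ * (ε₄ + B₀ * (2 * dL * C₁ * ε₁)) ^ 2)) ≤ c₂ * η * z)
    (hma : m * (κr * ((ε₄ + B₀ * (2 * dL * C₁ * ε₁)) + B₀ * (4 * C₂ * (ε₄ + B₀ * (2 * dL * C₁ * ε₁)) ^ 2))) ≤ 1)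
    (hsm : 36 * (c₁ * z + m ^ 2 * c₂ ^ 2 * z ^ 2) / (rΦ / S - 1) ^ 2 ≤ δ * εθ)
    -- THE DISPLAYED γ3 INPUT OF RECORD (leaf-01-g8 l.18489 ∕ leaf-08-g14 l.18568): radius `(d−1)·nb·a ≤ 2 sin(S∕2)`, a
    -- cover of the box plaquettes by a CORE set `A` (⊇ the plaquettes of `□^∼`) and a COLLAR set `B`, and the PAIR of
    -- readings — «sub-threshold ⟹ `A`-plaquettes `a`-small» (B14 (2.16)–(2.17) + average regularity, from `u < θ`) and
    -- «`F ≠ 0` ⟹ `B`-plaquettes `a`-small» (the density's KEPT co-tests, B15 (1.3)–(1.9) TYPE — a SUPPORT property);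
    -- located, NOT asserted — REPLACE `hreach′` of S87 f2b (hence `hFsupp` of S76 f2)
    {a : ℝ} (ha0 : 0 ≤ a) (hrad : ((P.d - 1 : ℕ) : ℝ) * nb * a ≤ 2 * Real.sin (S / 2))
    {A B : Set (Plaq P j)} (hcover : boxPlaqs lo hi ⊆ A ∪ B)
    (hcore : ∀ (V : GaugeField P j SU2) (y : ↥Λ → SU2),
      u (fixTo (combBonds lo hi) 1 (updateFinset V Λ y)) < εθ * η ^ 2 →
        PlaqSmallOn A a (fixTo (combBonds lo hi) 1 (updateFinset V Λ y)))
    (hcollar : ∀ (V : GaugeField P j SU2) (y : ↥Λ → SU2),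
      F (fixTo (combBonds lo hi) 1 (updateFinset V Λ y)) ≠ 0 →
        PlaqSmallOn B a (fixTo (combBonds lo hi) 1 (updateFinset V Λ y))) :
    SlotAntiConcentration ((fieldMeasure P j SU2).withDensity F) u (εθ * η ^ 2) ρ
      (2 * ((m₀ : ℝ) + (BW + BE)) / (1 - δ)) :=
  slotAC_realized_su2_landauChart_final_of_reach' (noClosedLoop_combBonds hN) 1 Λ e hS hSπ (fun _ => 1) hF hFi hu hui hPu
    W Jco 𝒢 W𝒱 h𝒢 hW hB₀ hC₄ hε₄ hdL hC₁ hε₁ hB₃ h1 h2 h3 H₁ hH₁ Φ hΦd hΦ0 hΦ hSr Cf hC₂ hCq hCd ιs hι Hop hH h18 hcoup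
    h3R ℓs hκ hℓ hlen hκc hcurl 𝓔W 𝓔E hEW hBW hEE hBE hWlb hElb L 𝓡𝒵 𝓡𝒴' 𝓡𝒳 h𝓡𝒳 𝓡ℬ h𝒢r hWr hιr hHr hCr hH₁r hΦr
    hRdict hudict hJW hJ hJ1 hWS hδ0 hδ1 hρ0 hρ hβ hη hεθ
    (hreach'_of_core_collar hn Λ hΛbox hΛcomb ha0 hrad hcover F hcore hcollar) hs₁ ha hma hsm

/-- **THE `B := ∅` COROLLARY** (S87 f3's one-reading form): the same END with the SINGLE reading `hsmall` — «sub-threshold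
⟹ ALL box plaquettes `a`-small» (S87 f3 `hreach_of_plaqSmall` over S87 f2 `…_final_of_reach`).  TRUE, and the special case
`A := boxPlaqs lo hi`, `B := ∅` of the theorem above; NOT the displayed reading of record (it over-asks the slot's own
sub-threshold event: (2.17)'s sup runs over `□^∼` only — leaf-01-g8 C-ne7cleaf01g8-1). [folklore] -/
theorem slotAC_realized_su2_landauChart_final_of_plaqSmall
    -- the BOX `[lo, hi]` (the block `□^{∼4}`: `nb` unit steps per direction, non-wrapping on the torus) and its axial comb
    {lo hi : Fin P.d → ℤ} {nb : ℕ} (hn : ∀ κ, hi κ ≤ lo κ + nb) (hN : ∀ κ, hi κ - lo κ < P.sitesPerDir j)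
    (Λ : Finset (PBond P j)) (hΛbox : ∀ b ∈ Λ, b ∈ boxBonds lo hi) (hΛcomb : Disjoint Λ (combBonds lo hi))
    {m₀ : ℕ} (e : ↥Λ × Fin 3 ≃ Fin m₀)
    {S : ℝ} (hS : 0 < S) (hSπ : 3 * S ^ 2 < Real.pi ^ 2)
    {F : GaugeField P j SU2 → ℝ≥0∞} (hF : Measurable F) (hFi : GaugeInvariant F)
    {u : GaugeField P j SU2 → ℝ} (hu : Measurable u) (hui : GaugeInvariant u)
    {ι : Type*} {Pu : Finset ι} (hPu : Pu.Nonempty)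
    (W : GaugeField P j SU2 → Set (Fin m₀ → ℝ)) (Jco : GaugeField P j SU2 → (Fin m₀ → ℝ) → ℝ≥0∞)
    {δ ρ β : ℝ}
    (𝒢 : GaugeField P j SU2 → (𝒵 →L[ℂ] 𝒴)) (W𝒱 : GaugeField P j SU2 → 𝒴 → 𝒵) {B₀ C₄ a₃ ε₄ : ℝ}
    (h𝒢 : ∀ V f, ‖𝒢 V f‖ ≤ B₀ * ‖f‖) (hW : ∀ V, Prop4Hyp (W𝒱 V) C₄ a₃) (hB₀ : 0 < B₀) (hC₄ : 0 ≤ C₄)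
    (hε₄ : 0 ≤ ε₄)
    {dL C₁ B₃ ε₁ : ℝ} (hdL : 0 ≤ dL) (hC₁ : 0 ≤ C₁) (hε₁ : 0 ≤ ε₁) (hB₃ : dL ≤ B₃)
    (h1 : 2 * B₀ * C₁ * B₃ * ε₁ ≤ ε₄) (h2 : 4 * ε₄ ≤ a₃) (h3 : 16 * B₀ * C₄ * ε₄ ≤ 1)
    (H₁ : GaugeField P j SU2 → (ℬ →L[ℂ] 𝒴)) (hH₁ : ∀ V B, ‖H₁ V B‖ ≤ B₀ * ‖B‖)
    (Φ : GaugeField P j SU2 → (Fin m₀ → ℂ) → ℬ) {rΦ : ℝ} (hΦd : ∀ V, DifferentiableOn ℂ (Φ V) (ball 0 rΦ))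
    (hΦ0 : ∀ V, Φ V 0 = 0) (hΦ : ∀ V, ∀ z ∈ ball (0 : Fin m₀ → ℂ) rΦ, ‖Φ V z‖ < 2 * dL * C₁ * ε₁) (hSr : S < rΦ)
    (Cf : GaugeField P j SU2 → 𝒴' → 𝒳) {C₂ RC : ℝ} (hC₂ : 0 ≤ C₂)
    (hCq : ∀ V, ∀ Z : 𝒴', ‖Z‖ < RC → ‖Cf V Z‖ ≤ C₂ * ‖Z‖ ^ 2) (hCd : ∀ V, DifferentiableOn ℂ (Cf V) (ball 0 RC))
    (ιs : GaugeField P j SU2 → (𝒴 →L[ℂ] 𝒴')) (hι : ∀ V Y, ‖ιs V Y‖ ≤ ‖Y‖)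
    (Hop : GaugeField P j SU2 → (𝒳 →L[ℂ] 𝒴)) (hH : ∀ V X, ‖Hop V X‖ ≤ B₀ * ‖X‖)
    {ε₃ : ℝ} (h18 : 18 * C₂ * B₀ * ε₃ ≤ 1) (hcoup : ε₄ + B₀ * (2 * dL * C₁ * ε₁) ≤ ε₃) (h3R : 3 * ε₃ ≤ RC)
    (ℓs : ι → List (𝒴 →L[ℂ] Matrix n n ℂ)) {κr : ℝ} (hκ : 0 ≤ κr)
    (hℓ : ∀ p ∈ Pu, ∀ ℓ ∈ ℓs p, ∀ Y, ‖ℓ Y‖ ≤ κr * ‖Y‖) {m : ℕ} (hlen : ∀ p ∈ Pu, (ℓs p).length ≤ m)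
    {κc : ℝ} (hκc : 0 ≤ κc) (hcurl : ∀ p ∈ Pu, ∀ Y, ‖((ℓs p).map fun ℓ => ℓ Y).sum‖ ≤ κc * ‖Y‖)
    -- THE TWO 𝓔-SLOTS (R-ne7cp1-g31-1): the WILSON part `𝓔W` (S74 `hE_landau_wilsonSquares(_pinned)` fills `hEW`; the Wilson
    -- density is nonnegative: `hWlb`) and the NON-WILSON part `𝓔E` (S71 f2 ∕ S78 fills `hEE`; a displayed lower bound `hElb`)
    (𝓔W 𝓔E : GaugeField P j SU2 → (Fin m₀ → ℝ) → ℝ) {BW BE BElb : ℝ}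
    (hEW : ∀ V, ∀ x ∈ W V, ∀ c' : ℝ, 1 / 2 ≤ c' → c' ≤ 1 → 𝓔W V (c' • x) ≤ 𝓔W V x + (1 - c') * BW) (hBW : 0 ≤ BW)
    (hEE : ∀ V, ∀ x ∈ W V, ∀ c' : ℝ, 1 / 2 ≤ c' → c' ≤ 1 → 𝓔E V (c' • x) ≤ 𝓔E V x + (1 - c') * BE) (hBE : 0 ≤ BE)
    (hWlb : ∀ V (y : Fin m₀ → ℝ), ‖y‖ ≤ S → 0 ≤ 𝓔W V y)
    (hElb : ∀ V (y : Fin m₀ → ℝ), ‖y‖ ≤ S → -BElb ≤ 𝓔E V y)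
    (L : Set (𝒴 →L[ℂ] Matrix n n ℂ))
    (𝓡𝒵 : AddSubgroup 𝒵) (𝓡𝒴' : AddSubgroup 𝒴') (𝓡𝒳 : AddSubgroup 𝒳) (h𝓡𝒳 : IsClosed (𝓡𝒳 : Set 𝒳))
    (𝓡ℬ : AddSubgroup ℬ)
    (h𝒢r : ∀ V, ∀ f ∈ 𝓡𝒵, 𝒢 V f ∈ readOutReal L) (hWr : ∀ V, ∀ Y ∈ readOutReal L, W𝒱 V Y ∈ 𝓡𝒵)
    (hιr : ∀ V, ∀ Y ∈ readOutReal L, ιs V Y ∈ 𝓡𝒴') (hHr : ∀ V, ∀ X ∈ 𝓡𝒳, Hop V X ∈ readOutReal L)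
    (hCr : ∀ V, ∀ Z ∈ 𝓡𝒴', Cf V Z ∈ 𝓡𝒳) (hH₁r : ∀ V, ∀ B ∈ 𝓡ℬ, H₁ V B ∈ readOutReal L)
    (hΦr : ∀ V, ∀ y : Fin m₀ → ℝ, ‖y‖ ≤ S → Φ V (cplx y) ∈ 𝓡ℬ)
    (hRdict : ∀ V, ∀ x ∈ cube m₀ S,
      F (fixTo (combBonds lo hi) 1 (updateFinset V Λ (expFibreChart Λ 1 e x))) =
        Jco V x * ENNReal.ofReal (Real.exp (-(𝓔W V x + 𝓔E V x))))
    (hudict : ∀ V, ∀ x ∈ cube m₀ S,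
      u (fixTo (combBonds lo hi) 1 (updateFinset V Λ (expFibreChart Λ 1 e x))) =
        classifier hPu (fun p => holOf (ℓs p) (fun y => landauExp (Cf V) (ιs V) (Hop V)
          (4 * C₂ * (ε₄ + B₀ * (2 * dL * C₁ * ε₁)) ^ 2)
          (solAt (𝒢 V) 0 (W𝒱 V) ε₄ (0 : 𝒵) (H₁ V (Φ V (cplx y))) + H₁ V (Φ V (cplx y))))) x)
    (hJW : ∀ V x, Jco V x ≠ 0 → x ∈ W V)
    (hJ : ∀ V x, ∀ a : ℝ, 0 ≤ a → Jco V x ≤ Jco V (Real.exp (-a) • x))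
    (hJ1 : ∀ V x, Jco V x ≤ 1)
    (hWS : ∀ V, W V ⊆ closedBall (0 : Fin m₀ → ℝ) S)
    (hδ0 : 0 ≤ δ) (hδ1 : δ < 1) (hρ0 : 0 ≤ ρ) (hρ : ρ ≤ (1 - δ) / 2) (hβ : 0 ≤ β)
    -- SM-L2 (SM) DISCHARGED IN THE STOKES CURRENCY (S73 `hSM_of_stokes`): the η-scalings of the classifier's read-out data
    -- DISPLAYED — curl read-out × field size `κ_c·z̄ ≤ c₁η²z` (B11 (25)∕(37) TYPE), letter size `κ_r·z̄ ≤ c₂ηz` ((19) TYPE),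
    -- regime `m·κ_r·z̄ ≤ 1` — the UNIT-currency smallness `36(c₁z + m²c₂²z²)∕(r_Φ∕S − 1)² ≤ δ·εθ`, and the classifier
    -- threshold `θ := εθ·η²` (B14 (2.17) TYPE): the `η²` CANCELS
    {η εθ c₁ c₂ z : ℝ} (hη : 0 < η) (hεθ : 0 < εθ)
    (hs₁ : κc * ((ε₄ + B₀ * (2 * dL * C₁ * ε₁)) + B₀ * (4 * C₂ * (ε₄ + B₀ * (2 * dL * C₁ * ε₁)) ^ 2)) ≤ c₁ * η ^ 2 * z)
    (ha : κr * ((ε₄ + B₀ * (2 * dL * C₁ * ε₁)) + B₀ * (4 * C₂ * (ε₄ + B₀ * (2 * dL * C₁ * ε₁)) ^ 2)) ≤ c₂ * η * z)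
    (hma : m * (κr * ((ε₄ + B₀ * (2 * dL * C₁ * ε₁)) + B₀ * (4 * C₂ * (ε₄ + B₀ * (2 * dL * C₁ * ε₁)) ^ 2))) ≤ 1)
    (hsm : 36 * (c₁ * z + m ^ 2 * c₂ ^ 2 * z ^ 2) / (rΦ / S - 1) ^ 2 ≤ δ * εθ)
    -- THE ONE DISPLAYED READING (S87 f3 `hreach_of_plaqSmall`): at every comb-fixed section, a SUB-THRESHOLD tested variable
    -- makes the box plaquettes `a`-small (B14 (2.16)–(2.17) + [B7] Props 1∕2 TYPE — located, NOT asserted), with the radius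
    -- `(d−1)·nb·a ≤ 2 sin(S∕2)` — REPLACES `hreach` of S87 f2 (hence `hFsupp` of S76 f2)
    {a : ℝ} (ha0 : 0 ≤ a) (hrad : ((P.d - 1 : ℕ) : ℝ) * nb * a ≤ 2 * Real.sin (S / 2))
    (hsmall : ∀ (V : GaugeField P j SU2) (y : ↥Λ → SU2),
      u (fixTo (combBonds lo hi) 1 (updateFinset V Λ y)) < εθ * η ^ 2 →
        PlaqSmallOn (boxPlaqs lo hi) a (fixTo (combBonds lo hi) 1 (updateFinset V Λ y))) :
    SlotAntiConcentration ((fieldMeasure P j SU2).withDensity F) u (εθ * η ^ 2) ρ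
      (2 * ((m₀ : ℝ) + (BW + BE)) / (1 - δ)) :=
  slotAC_realized_su2_landauChart_final_of_reach (noClosedLoop_combBonds hN) 1 Λ e hS hSπ (fun _ => 1) hF hFi hu hui hPu
    W Jco 𝒢 W𝒱 h𝒢 hW hB₀ hC₄ hε₄ hdL hC₁ hε₁ hB₃ h1 h2 h3 H₁ hH₁ Φ hΦd hΦ0 hΦ hSr Cf hC₂ hCq hCd ιs hι Hop hH h18 hcoup
    h3R ℓs hκ hℓ hlen hκc hcurl 𝓔W 𝓔E hEW hBW hEE hBE hWlb hElb L 𝓡𝒵 𝓡𝒴' 𝓡𝒳 h𝓡𝒳 𝓡ℬ h𝒢r hWr hιr hHr hCr hH₁r hΦr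
    hRdict hudict hJW hJ hJ1 hWS hδ0 hδ1 hρ0 hρ hβ hη hεθ
    (hreach_of_plaqSmall hn Λ hΛbox hΛcomb ha0 hrad hsmall) hs₁ ha hma hsm

end Final

/-! ## §3 (x1) Crew rule G-1: the box∕reading family jointly inhabited on a concrete torus box, `Λ ≠ ∅` -/

section Witness

open scoped Matrix.Norms.L2Operator

/-- **RULE G-1 WITNESS FOR THE γ3 FAMILY.**  On leaf-10-g11's concrete torus `toyParams` (`d = 2`, `L = 3`, `m = 1`,
`K = 0`: six sites per direction) at level `0`, the side-2 box at corner `0` with its axial comb: the box data of §1∕§2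
(`hn` with `nb = 2`, the non-wrapping `hN`, hence `NoClosedLoop (combBonds …)`, the block `Λ := blockBonds` NONEMPTY and
`⊆ boxBonds`, DISJOINT from the comb), the window numbers (`S := 1`: `3S² < π²`; `a := sin(1∕2) > 0`:
`(d−1)·nb·a ≤ 2 sin(S∕2)` with equality), the box plaquettes NONEMPTY, and the PAIR of readings inhabited NON-VACUOUSLY —
core with the tested variable `u := max_{p ∈ boxPlaqF} dist1(U(∂p))` and `θ := a` (the box maximum below `a` IS
`PlaqSmallOn box a`), collar with `F := 𝟙{PlaqSmallOn box a}` (`F ≠ 0` IS the smallness), cover `box ⊆ box ∪ box` — so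
that `hreach'_of_core_collar` FIRES and PRODUCES the END's support-relative reach on this nonempty block for `G := SU2`.
(The S77 lesson, F-ne7cleaf02g9-1: a geometric family can be vacuous; this one is not.) [folklore] -/
theorem reach_family_inhabited [DecidableEq (PBond toyParams 0)] :
    (∀ κ, (fun _ : Fin toyParams.d => (0 : ℤ) + 2) κ ≤ (0 : Fin toyParams.d → ℤ) κ + ((2 : ℕ) : ℤ)) ∧
    (∀ κ, (fun _ : Fin toyParams.d => (0 : ℤ) + 2) κ - (0 : Fin toyParams.d → ℤ) κ < (toyParams.sitesPerDir 0 : ℤ)) ∧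
    NoClosedLoop (combBonds (P := toyParams) (j := 0) 0 (fun _ => (0 : ℤ) + 2)) ∧
    (blockBonds (P := toyParams) (j := 0) 0 (fun _ => (0 : ℤ) + 2)).Nonempty ∧
    (∀ b ∈ blockBonds (P := toyParams) (j := 0) 0 (fun _ => (0 : ℤ) + 2),
      b ∈ boxBonds (P := toyParams) (j := 0) 0 (fun _ => (0 : ℤ) + 2)) ∧
    Disjoint (blockBonds (P := toyParams) (j := 0) 0 (fun _ => (0 : ℤ) + 2)) (combBonds 0 (fun _ => (0 : ℤ) + 2)) ∧
    3 * (1 : ℝ) ^ 2 < Real.pi ^ 2 ∧ 0 < Real.sin (1 / 2) ∧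
    ((toyParams.d - 1 : ℕ) : ℝ) * (2 : ℕ) * Real.sin (1 / 2) ≤ 2 * Real.sin (1 / 2) ∧
    ∃ hPu : (boxPlaqF (P := toyParams) (j := 0) 0 (fun _ => (0 : ℤ) + 2)).Nonempty,
      ∀ (V : GaugeField toyParams 0 SU2) (y : ↥(blockBonds (P := toyParams) (j := 0) 0 (fun _ => (0 : ℤ) + 2)) → SU2),
        (boxPlaqF (P := toyParams) (j := 0) 0 (fun _ => (0 : ℤ) + 2)).sup' hPu (fun p => dist1 (GaugeField.plaqHol
          (fixTo (combBonds 0 (fun _ => (0 : ℤ) + 2)) 1 (updateFinset V _ y)) p)) < Real.sin (1 / 2) →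
        ({W : GaugeField toyParams 0 SU2 | PlaqSmallOn (boxPlaqs 0 (fun _ => (0 : ℤ) + 2)) (Real.sin (1 / 2)) W}.indicator
          (1 : GaugeField toyParams 0 SU2 → ℝ≥0∞)) (fixTo (combBonds 0 (fun _ => (0 : ℤ) + 2)) 1 (updateFinset V _ y)) ≠ 0 →
        ∀ b (hb : b ∈ blockBonds (P := toyParams) (j := 0) 0 (fun _ => (0 : ℤ) + 2)),
          dist1 (((1 : GaugeField toyParams 0 SU2) b)⁻¹ * y ⟨b, hb⟩) ≤ 2 * Real.sin (1 / 2) := by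
  have hd : 2 ≤ toyParams.d := le_rfl
  have h3 : 3 ≤ toyParams.sitesPerDir 0 := by rw [toyParams_sitesPerDir]; norm_num
  have h01 := dir_zero_lt_one hd
  have hsq := side_two_square (P := toyParams) (0 : Fin toyParams.d → ℤ) _ _ h01
  have hN := side_two_nonwrapping (j := 0) h3 (0 : Fin toyParams.d → ℤ)
  have hn := side_two_side (P := toyParams) (0 : Fin toyParams.d → ℤ)
  have hPu := boxPlaqF_nonempty (P := toyParams) (j := 0) h01 hsq
  have hsin : 0 < Real.sin (1 / 2) := Real.sin_pos_of_pos_of_lt_pi (by norm_num) (by linarith [Real.pi_gt_three])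
  have hrad : ((toyParams.d - 1 : ℕ) : ℝ) * (2 : ℕ) * Real.sin (1 / 2) ≤ 2 * Real.sin (1 / 2) := by
    simp only [toyParams, Nat.cast_ofNat]
    norm_num
  refine ⟨hn, hN, noClosedLoop_combBonds hN, blockBonds_nonempty hN h01 hsq, blockBonds_box 0 _,
    disjoint_blockBonds_comb 0 _, by nlinarith [Real.pi_gt_three], hsin, hrad, hPu, ?_⟩
  -- the readings: core = «the box max is sub-a», collar = «the kept co-test IS the support», cover trivial
  exact hreach'_of_core_collar (G := SU2) hn (blockBonds 0 _) (blockBonds_box 0 _) (disjoint_blockBonds_comb 0 _) hsin.le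
    hrad (A := boxPlaqs 0 (fun _ => (0 : ℤ) + 2)) (B := boxPlaqs 0 (fun _ => (0 : ℤ) + 2)) (fun p hp => Or.inl hp)
    (u := fun W => (boxPlaqF (P := toyParams) (j := 0) 0 (fun _ => (0 : ℤ) + 2)).sup' hPu
      (fun p => dist1 (GaugeField.plaqHol W p))) (θ := Real.sin (1 / 2))
    ({W : GaugeField toyParams 0 SU2 | PlaqSmallOn (boxPlaqs 0 (fun _ => (0 : ℤ) + 2)) (Real.sin (1 / 2)) W}.indicator
      (1 : GaugeField toyParams 0 SU2 → ℝ≥0∞))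
    (fun V y hu p hp => (Finset.sup'_lt_iff hPu).1 hu p (mem_boxPlaqF.2 hp))
    (fun V y hF => by
      by_contra h
      exact hF (indicator_of_notMem h _))

end Witness

end Summit.QuantumFields.BalabanUV.T4Continuum.ShellMeasureLandauEndWindowReach

end
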